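import Summits.QuantumFields.YangMills.Theorems.MirrorModularBoostsSoftKernelBoostCovarianceDiagGrowthTHelpers
import HarnessLib

/-!
# `SoftKernelBoostCovariance`, line `Sketch` v3.12: stub (G) `stub_diagGrowthT` — growth of the unordered `e₀`-norms of a
# box-localised DIAGONAL chain (frame dictionary + transport + (C) + (D))

Support file for crux stmt-QuantumFields-14999 (`MirrorModularBoosts.SoftKernelBoostCovariance`), skeleton `Lines/Sketch.lean` v3.12.
The `45°` chain `P⟨m, G⟩ = ⟨2+m, T_s(Θf̄ ⊗ (f ⊗ T_s G))⟩` of a box insertion (times `[c, c+δ]`, `|x₁| ≤ δ`, `δ = min(u,v)/32`,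
`s = 2u+v`) read in the `e₀` frame of `S₁` (helpers: `…DiagGrowthTHelpers`): every slot of `(PᴺW)∘R^{∓1}` has `e₀`-time `≥ α₁` once
`N ≥ m+1` (`tsupport_linAct_ge`), the reserve sums of (C) are `≤ 2·3^μ(u^{-μ}+v^{-μ})` (`reserve_bounds`, `√2/2 ≥ 7/10`), and the landed
(C) `stub_diagCorePeel` + (D) `stub_diagCloudGrowth` give `Re ⟪U_N, U_N⟫ ≤ K·Λ^{4N}`, `Λ = 2·3^μ·C·Mg·(Mh+Mh')·(u^{-μ}+v^{-μ})`
(`frame_growth`, one frame; `stub_diagGrowthT`, both frames).  References: Glimm–Jaffe 1987 §10.5; Osterwalder–Schrader 1973 §4.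
-/

noncomputable section

namespace Summit.QuantumFields.YangMills.Theorems.SoftKernelBoostCovariance.Sketch

open scoped BigOperators SchwartzMap InnerProductSpace ComplexConjugate
open MeasureTheory Filter Topology
open Literature.MathematicalPhysics.QuantumLattice Literature.MathematicalPhysics.AQFT
  Literature.MathematicalPhysics.QuantumFieldTheory
open Summit.QuantumFields.YangMills.Theorems.NPointIsotropy.Negative (E4 NPointRegular)
open Summit.QuantumFields.YangMills.Theorems.CurvatureSandwichBound.Negative (SandwichBound)

namespace DiagGrowthT

/-- **Reading supports in the other frame**: if every slot of the support of `X` satisfies `x⁰ − |x¹| ≥ b`, then every slot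
of the support of `X ∘ R_θ⁻¹` has time `≥ k b` (`cos θ = k = |sin θ|`). -/
theorem tsupport_linAct_ge (θ : ℝ) {kk b : ℝ} (hcos : Real.cos θ = kk) (hsin : |Real.sin θ| = kk) (hk : 0 ≤ kk)
    {d : ℕ} (X : 𝓢((Fin d → E4), ℂ)) (hX : tsupport (X : (Fin d → E4) → ℂ) ⊆ {x | ∀ i, b ≤ x i 0 - |x i 1|}) :
    tsupport ((linActMulti (planeRot (0 : Fin 3) θ) X : 𝓢((Fin d → E4), ℂ)) : (Fin d → E4) → ℂ) ⊆
      {y | ∀ i, kk * b ≤ y i 0} := by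
  refine closure_minimal (fun y hy i => ?_) (DiagCloud.isClosed_setOf_forall_le _)
  rw [Function.mem_support, linActMulti_apply] at hy
  have hx : (fun i => (planeRot (0 : Fin 3) θ).symm (y i)) ∈ tsupport (X : (Fin d → E4) → ℂ) :=
    subset_tsupport _ (Function.mem_support.2 hy)
  have h := hX hx i
  obtain ⟨h0, -, -, -⟩ := planeRot_coord θ ((planeRot (0 : Fin 3) θ).symm (y i))
  rw [LinearIsometryEquiv.apply_symm_apply] at h0
  set x := (planeRot (0 : Fin 3) θ).symm (y i) with hxdef
  have h1 : -(kk * |x 1|) ≤ Real.sin θ * x 1 := by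
    have := neg_abs_le (Real.sin θ * x 1)
    rw [abs_mul, hsin] at this
    exact this
  show kk * b ≤ y i 0
  rw [h0, hcos]
  dsimp only at h
  nlinarith [mul_le_mul_of_nonneg_left h hk]

/-- One reserve term: `x ≥ min(u,v)/3 > 0` gives `x^{-μ} ≤ 3^μ (u^{-μ} + v^{-μ})` (`μ ≥ 0`, `u, v > 0`). -/
theorem rpow_neg_le_of_ge {u v x μ : ℝ} (hu : 0 < u) (hv : 0 < v) (hμ : 0 ≤ μ) (hx : min u v / 3 ≤ x) :
    x ^ (-μ) ≤ (3 : ℝ) ^ μ * (u ^ (-μ) + v ^ (-μ)) := by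
  have hm : 0 < min u v := lt_min hu hv
  have hm3 : 0 < min u v / 3 := by positivity
  have h1 : x ^ (-μ) ≤ (min u v / 3) ^ (-μ) := Real.rpow_le_rpow_of_nonpos hm3 hx (by linarith)
  have h2 : (min u v / 3) ^ (-μ) = (3 : ℝ) ^ μ * (min u v) ^ (-μ) := by
    rw [Real.div_rpow hm.le (by norm_num), Real.rpow_neg (by norm_num : (0 : ℝ) ≤ 3), div_eq_mul_inv, inv_inv,
      mul_comm]
  have h3 : (min u v) ^ (-μ) ≤ u ^ (-μ) + v ^ (-μ) := by
    rcases min_choice u v with h | h <;> rw [h]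
    · linarith [Real.rpow_nonneg hv.le (-μ)]
    · linarith [Real.rpow_nonneg hu.le (-μ)]
  calc x ^ (-μ) ≤ (min u v / 3) ^ (-μ) := h1
    _ = (3 : ℝ) ^ μ * (min u v) ^ (-μ) := h2
    _ ≤ (3 : ℝ) ^ μ * (u ^ (-μ) + v ^ (-μ)) :=
        mul_le_mul_of_nonneg_left h3 (Real.rpow_nonneg (by norm_num) μ)

/-- **The reserve sums of (C) for the transported geometry are `≤ 2·3^μ (u^{-μ} + v^{-μ})`.** -/
theorem reserve_bounds {u v c kk μ : ℝ} (hu : 0 < u) (hv : 0 < v) (hu1 : u ≤ 1) (hμ : 0 ≤ μ)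
    (huc : u ≤ c) (hc2 : c + min u v / 32 ≤ 2 * u) (hk : (7 : ℝ) / 10 ≤ kk) :
    (min (kk * (2 * u + v - c - 2 * (min u v / 32))) (2 * kk * (c - min u v / 32) / 4)) ^ (-μ) +
        (min (2 * kk * (c - min u v / 32) / 4) 1) ^ (-μ) ≤ 2 * (3 : ℝ) ^ μ * (u ^ (-μ) + v ^ (-μ)) ∧
    (min (2 * kk * (c - min u v / 32) / 2) (2 * kk * (2 * u + v - c - 2 * (min u v / 32)) / 4)) ^ (-μ) +
        (min (2 * kk * (2 * u + v - c - 2 * (min u v / 32)) / 4) 1) ^ (-μ) ≤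
      2 * (3 : ℝ) ^ μ * (u ^ (-μ) + v ^ (-μ)) := by
  set δ := min u v / 32 with hδ
  have hm : 0 < min u v := lt_min hu hv
  have hδu : δ ≤ u / 32 := by rw [hδ]; linarith [min_le_left u v]
  have hδv : δ ≤ v / 32 := by rw [hδ]; linarith [min_le_right u v]
  have hδ0 : 0 ≤ δ := by rw [hδ]; positivity
  have hsc : v - δ ≤ 2 * u + v - c - 2 * δ := by linarith
  have hmu : min u v ≤ u := min_le_left u v
  have hmv : min u v ≤ v := min_le_right u v
  have hk0 : 0 ≤ kk := by linarith
  -- the four lower bounds by `min u v / 3`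
  have hα₁ : min u v / 3 ≤ kk * (2 * u + v - c - 2 * δ) := by
    have : (7 : ℝ) / 10 * (v - δ) ≤ kk * (2 * u + v - c - 2 * δ) :=
      mul_le_mul hk hsc (by linarith) hk0
    nlinarith
  have hγ₁ : min u v / 3 ≤ 2 * kk * (c - δ) / 4 := by
    have : (7 : ℝ) / 10 * (u - δ) ≤ kk * (c - δ) := mul_le_mul hk (by linarith) (by linarith) hk0
    nlinarith
  have hγ₁' : min u v / 3 ≤ 2 * kk * (c - δ) / 2 := by
    have h0 : 0 ≤ 2 * kk * (c - δ) := by nlinarith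
    linarith
  have hγ₂ : min u v / 3 ≤ 2 * kk * (2 * u + v - c - 2 * δ) / 4 := by
    have : (7 : ℝ) / 10 * (v - δ) ≤ kk * (2 * u + v - c - 2 * δ) := mul_le_mul hk hsc (by linarith) hk0
    nlinarith
  have hone : min u v / 3 ≤ 1 := by linarith
  have t1 := rpow_neg_le_of_ge hu hv hμ (le_min hα₁ hγ₁)
  have t2 := rpow_neg_le_of_ge hu hv hμ (le_min hγ₁ hone)
  have t3 := rpow_neg_le_of_ge hu hv hμ (le_min hγ₁' hγ₂)
  have t4 := rpow_neg_le_of_ge hu hv hμ (le_min hγ₂ hone)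
  constructor <;> linarith

/-- `linActMulti R_θ⁻¹ = linActMulti R_{−θ}` (as operations on test functions). -/
theorem linActMulti_planeRot_symm (θ : ℝ) {d : ℕ} (V : 𝓢((Fin d → E4), ℂ)) :
    linActMulti (planeRot (0 : Fin 3) θ).symm V = linActMulti (planeRot (0 : Fin 3) (-θ)) V := by
  ext x
  simp only [linActMulti_apply, LinearIsometryEquiv.symm_symm, planeRot_symm_apply, neg_neg]

set_option maxHeartbeats 800000 in
/-- **Growth of the unordered `e₀`-norms of the diagonal chain read in ONE frame** `R_θ` with `cos θ = |sin θ| = √2/2`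
(`θ = ±π/4`): for all `N ≥ m+1` (`2m(2u+v) ≥ ℓ_W + (2u+v)`), `(PᴺW) ∘ R_θ⁻¹` is positive-time and off-diagonal and
`Re ⟪(PᴺW)∘R_θ⁻¹, (PᴺW)∘R_θ⁻¹⟫_{S₁} ≤ K·Λ^{4N}`. -/
theorem frame_growth (S₁ : SchwingerFamily E4) (h : OSReconstructionNoE1 S₁.toLabelled) {μ C : ℝ} (hμ : 0 ≤ μ)
    (hC : 0 < C) (hE3 : S₁.toLabelled.IsSymmetric) (hreg : NPointRegular S₁) (hSB : SandwichBound S₁ h μ C)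
    {u v c : ℝ} (hu : 0 < u) (hv : 0 < v) (hu1 : u ≤ 1) (hv1 : v ≤ 1) (huc : u ≤ c)
    (hc2 : c + min u v / 32 ≤ 2 * u)
    {f : 𝓢((Fin 1 → E4), ℂ)} {g hh : ℝ × ℝ → ℂ} {Mg Mh Mh' : ℝ}
    (hf : ∀ x, f x = g (x 0 0, x 0 1) * hh (x 0 2, x 0 3))
    (hg : ∀ p, g p ≠ 0 → (c ≤ p.1 ∧ p.1 ≤ c + min u v / 32) ∧ |p.2| ≤ min u v / 32)
    (hgi : Integrable g) (hgM : (∫ p, ‖g p‖) ≤ Mg) (hMg : 0 < Mg)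
    (hhi : Integrable hh) (hhM : (∫ p, ‖hh p‖) ≤ Mh) (hhM' : ∀ p, ‖hh p‖ ≤ Mh')
    {n : ℕ} (W : 𝓢((Fin n → E4), ℂ)) (hW : IsTimeOrdered W) {ℓW : ℝ}
    (hWt : tsupport (W : (Fin n → E4) → ℂ) ⊆ {x | ∀ i, 0 ≤ x i 0 ∧ |x i 1| ≤ ℓW})
    (hFW : IsTimeOrdered (f.appendTensor (translateMulti ((2 * u + v) • EuclideanSpace.single 0 1) W)))
    (P : (Σ m : ℕ, 𝓢((Fin m → E4), ℂ)) → (Σ m : ℕ, 𝓢((Fin m → E4), ℂ)))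
    (hP : P = fun Gσ => ⟨1 + (1 + Gσ.1), translateMulti ((2 * u + v) • EuclideanSpace.single 0 1)
      ((osAdjoint f).appendTensor
        (f.appendTensor (translateMulti ((2 * u + v) • EuclideanSpace.single 0 1) Gσ.2)))⟩)
    (m : ℕ) (hm : ℓW + (2 * u + v) ≤ 2 * m * (2 * u + v))
    (θ : ℝ) (hcos : Real.cos θ = Real.sqrt 2 / 2) (hsin : |Real.sin θ| = Real.sqrt 2 / 2) :
    ∃ K : ℝ, 0 ≤ K ∧ ∀ N : ℕ, m + 1 ≤ N →
      IsPositiveTimeMulti (linActMulti (planeRot (0 : Fin 3) θ) (P^[N] ⟨n, W⟩).2) ∧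
      IsOffDiagonal (linActMulti (planeRot (0 : Fin 3) θ) (P^[N] ⟨n, W⟩).2) ∧
      (S₁.osPairing (linActMulti (planeRot (0 : Fin 3) θ) (P^[N] ⟨n, W⟩).2)
          (linActMulti (planeRot (0 : Fin 3) θ) (P^[N] ⟨n, W⟩).2)).re ≤
        K * (2 * (3 : ℝ) ^ μ * C * Mg * (Mh + Mh') * (u ^ (-μ) + v ^ (-μ))) ^ (4 * N) := by
  -- scales and the frame (the reserve bounds are taken FIRST, so that the `set`s below rewrite them syntactically)
  obtain ⟨hk7, hk34⟩ := sqrt_two_div_two_bounds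
  obtain ⟨hB1, hB2⟩ := reserve_bounds (kk := Real.sqrt 2 / 2) (μ := μ) hu hv hu1 hμ huc hc2 hk7
  set kk : ℝ := Real.sqrt 2 / 2 with hkk
  have hk0 : 0 < kk := by linarith
  set s : ℝ := 2 * u + v with hs
  set δ : ℝ := min u v / 32 with hδ
  have hs0 : 0 < s := by rw [hs]; linarith
  have hδ0 : 0 ≤ δ := by rw [hδ]; positivity
  have hδu : δ ≤ u / 32 := by rw [hδ]; linarith [min_le_left u v]
  have hδv : δ ≤ v / 32 := by rw [hδ]; linarith [min_le_right u v]
  have hc0 : 0 ≤ c := by linarith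
  have hsc : v - δ ≤ s - c - 2 * δ := by rw [hs]; linarith
  have hMh0 : 0 ≤ Mh := (integral_nonneg fun _ => norm_nonneg _).trans hhM
  have hMh'0 : 0 ≤ Mh' := (norm_nonneg _).trans (hhM' 0)
  set L : E4 ≃ₗᵢ[ℝ] E4 := planeRot (0 : Fin 3) θ with hL
  set a : E4 := L (s • EuclideanSpace.single 0 1) with ha
  obtain ⟨ha0', ha1', ha2, ha3⟩ := smul_planeRot_e0 θ s
  have ha0 : a 0 = s * kk := by rw [ha, hL, ha0', hcos]
  set J₁ : 𝓢((Fin 1 → E4), ℂ) := linActMulti L (osAdjoint f) with hJ₁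
  set J₂ : 𝓢((Fin 1 → E4), ℂ) := linActMulti L f with hJ₂
  -- product forms of the transported insertions
  set g₁ : ℝ × ℝ → ℂ := fun p =>
    conj (g (-(Real.cos θ * p.1 - Real.sin θ * p.2), Real.sin θ * p.1 + Real.cos θ * p.2)) with hg₁
  set g₂ : ℝ × ℝ → ℂ := fun p =>
    g (Real.cos θ * p.1 - Real.sin θ * p.2, Real.sin θ * p.1 + Real.cos θ * p.2) with hg₂
  set hh₁ : ℝ × ℝ → ℂ := fun q => conj (hh q) with hhh₁
  have hJ₁f : ∀ x, J₁ x = g₁ (x 0 0, x 0 1) * hh₁ (x 0 2, x 0 3) := fun x => productForm₁ θ hf x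
  have hJ₂f : ∀ x, J₂ x = g₂ (x 0 0, x 0 1) * hh (x 0 2, x 0 3) := fun x => productForm₂ θ hf x
  -- masses
  obtain ⟨hg₂i, hg₂m⟩ := integrable_and_mass_comp (measurePreserving_ρ₂ θ) hgi
  obtain ⟨hg₁i', hg₁m'⟩ := integrable_and_mass_comp (measurePreserving_ρ₁ θ) hgi
  have hg₁i : Integrable g₁ := by
    have := Complex.conjCLE.toContinuousLinearMap.integrable_comp hg₁i'
    exact this
  have hg₁m : (∫ p, ‖g₁ p‖) = ∫ p, ‖g p‖ := by
    rw [← hg₁m']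
    refine integral_congr_ae (ae_of_all _ fun p => ?_)
    simp only [hg₁, Complex.norm_conj]
  have hg₁M : (∫ p, ‖g₁ p‖) ≤ Mg := hg₁m ▸ hgM
  have hg₂M : (∫ p, ‖g₂ p‖) ≤ Mg := hg₂m ▸ hgM
  have hhh₁i : Integrable hh₁ := by
    have := Complex.conjCLE.toContinuousLinearMap.integrable_comp hhi
    exact this
  have hhh₁M : (∫ p, ‖hh₁ p‖) ≤ Mh := by
    have : (∫ p, ‖hh₁ p‖) = ∫ p, ‖hh p‖ := integral_congr_ae (ae_of_all _ fun p => by simp [hhh₁])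
    rw [this]; exact hhM
  have hhh₁M' : ∀ p, ‖hh₁ p‖ ≤ Mh' := fun p => by simp only [hhh₁, Complex.norm_conj]; exact hhM' p
  -- windows
  set α₁ : ℝ := kk * (s - c - 2 * δ) with hα₁
  set α₂ : ℝ := kk * (s + c - δ) with hα₂
  set ℓ : ℝ := 3 * (kk * δ) with hℓ
  set γ₁ : ℝ := 2 * kk * (c - δ) with hγ₁
  set γ₂ : ℝ := 2 * kk * (s - c - 2 * δ) with hγ₂
  set B : ℝ := 2 * (3 : ℝ) ^ μ * (u ^ (-μ) + v ^ (-μ)) with hB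
  have hw₁ : ∀ p, g₁ p ≠ 0 → α₁ ≤ p.1 + a 0 ∧ p.1 + a 0 ≤ α₁ + ℓ := fun p hp => by
    rw [ha0]; exact window₁ θ hcos hsin hk0 hg s p hp
  have hw₂ : ∀ p, g₂ p ≠ 0 → α₂ ≤ p.1 + a 0 ∧ p.1 + a 0 ≤ α₂ + ℓ := fun p hp => by
    rw [ha0]; exact window₂ θ hcos hsin hk0 hg s p hp
  -- geometry of the windows
  have hα₁0 : 0 < α₁ := by rw [hα₁]; exact mul_pos hk0 (by linarith)
  have hℓ0 : 0 ≤ ℓ := by rw [hℓ]; positivity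
  have hcδ : 0 < c - δ := by linarith
  have hγ₁0 : 0 < γ₁ := by rw [hγ₁]; exact mul_pos (mul_pos two_pos hk0) hcδ
  have hγ₂0 : 0 < γ₂ := by rw [hγ₂]; exact mul_pos (mul_pos two_pos hk0) (by linarith)
  have hγ₁4 : γ₁ ≤ 4 := by
    have h1 : kk * (c - δ) ≤ 3 / 4 * 2 := mul_le_mul hk34 (by linarith) hcδ.le (by norm_num)
    rw [hγ₁]; linarith
  have hγ₂4 : γ₂ ≤ 4 := by
    have h1 : kk * (s - c - 2 * δ) ≤ 3 / 4 * 2 := by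
      refine mul_le_mul hk34 ?_ (by linarith) (by norm_num)
      rw [hs]; linarith
    rw [hγ₂]; linarith
  have hℓα : ℓ ≤ α₁ := by
    have h1 : 3 * δ ≤ s - c - 2 * δ := by linarith
    rw [hℓ, hα₁]
    calc 3 * (kk * δ) = kk * (3 * δ) := by ring
      _ ≤ kk * (s - c - 2 * δ) := mul_le_mul_of_nonneg_left h1 hk0.le
  have hℓγ₁ : 4 * ℓ ≤ γ₁ := by
    have h1 : 12 * δ ≤ 2 * (c - δ) := by linarith
    rw [hℓ, hγ₁]
    calc 4 * (3 * (kk * δ)) = kk * (12 * δ) := by ring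
      _ ≤ kk * (2 * (c - δ)) := mul_le_mul_of_nonneg_left h1 hk0.le
      _ = 2 * kk * (c - δ) := by ring
  have hℓγ₂ : 4 * ℓ ≤ γ₂ := by
    have h1 : 12 * δ ≤ 2 * (s - c - 2 * δ) := by linarith
    rw [hℓ, hγ₂]
    calc 4 * (3 * (kk * δ)) = kk * (12 * δ) := by ring
      _ ≤ kk * (2 * (s - c - 2 * δ)) := mul_le_mul_of_nonneg_left h1 hk0.le
      _ = 2 * kk * (s - c - 2 * δ) := by ring
  have hsum₁ : α₁ + ℓ + γ₁ ≤ α₂ := by rw [hα₁, hℓ, hγ₁, hα₂]; exact le_of_eq (by ring)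
  have hsum₂ : α₂ + ℓ + γ₂ ≤ α₁ + 2 * a 0 := by rw [hα₂, hℓ, hγ₂, hα₁, ha0]; exact le_of_eq (by ring)
  have hhalf : α₂ + γ₂ / 2 ≤ 2 * a 0 := by
    have h1 : kk * (s + c - δ) + 2 * kk * (s - c - 2 * δ) / 2 = 2 * (s * kk) - 3 * (kk * δ) := by ring
    rw [hα₂, hγ₂, ha0, h1]
    linarith [mul_nonneg hk0.le hδ0]
  -- the `e₀` chain
  obtain ⟨Q, hQ⟩ : ∃ Q : (Σ m : ℕ, 𝓢((Fin m → E4), ℂ)) → (Σ m : ℕ, 𝓢((Fin m → E4), ℂ)),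
      Q = fun Gσ => ⟨1 + (1 + Gσ.1), translateMulti a (J₁.appendTensor (J₂.appendTensor (translateMulti a Gσ.2)))⟩ :=
    ⟨_, rfl⟩
  -- (C): time-ordered clouds
  have hCore := stub_diagCorePeel S₁ h μ C hμ hC hSB a J₁ J₂ g₁ g₂ hh₁ hh Mg Mh Mh' α₁ α₂ ℓ γ₁ γ₂ B ha2 ha3
    hJ₁f hJ₂f hg₁i hg₂i hg₁M hg₂M hMg hhh₁i hhi hhh₁M hhM hhh₁M' hhM' hw₁ hw₂ hα₁0 hℓ0 hγ₁0 hγ₂0 hγ₁4 hγ₂4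
    hℓα hℓγ₁ hℓγ₂ hsum₁ hsum₂ hhalf hB1 hB2 Q hQ
  obtain ⟨Lr, hLr⟩ : ∃ Lr : ℝ, Lr = (C * Mg * (Mh + Mh') * B) ^ 2 := ⟨_, rfl⟩
  have hLr0 : 0 ≤ Lr := by rw [hLr]; positivity
  have hGrowth : ∀ (n' : ℕ) (Z : 𝓢((Fin n' → E4), ℂ)) (hZ : IsTimeOrdered Z),
      tsupport (Z : (Fin n' → E4) → ℂ) ⊆ {x | ∀ i, α₁ ≤ x i 0} →
      ∀ N : ℕ, ∃ hN : IsTimeOrdered (Q^[N] ⟨n', Z⟩).2,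
        ‖h.fieldVec (Q^[N] ⟨n', Z⟩).1 (fun _ => ()) (Q^[N] ⟨n', Z⟩).2 hN‖ ≤
          Lr ^ N * ‖h.fieldVec n' (fun _ => ()) Z hZ‖ := by
    intro n' Z hZ hZs N
    obtain ⟨hN, -, hb⟩ := hCore n' Z hZ hZs N
    refine ⟨hN, ?_⟩
    rw [hLr, ← pow_mul]
    exact hb
  -- the cloud after `m` periods
  have hfwin : tsupport (f : (Fin 1 → E4) → ℂ) ⊆ {x | u ≤ x 0 0 ∧ x 0 0 ≤ 2 * u} := fun x hx => by
    obtain ⟨⟨h1, h2⟩, -⟩ := tsupport_f_subset hf hg hx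
    exact ⟨huc.trans h1, h2.trans hc2⟩
  have hadm := Summit.QuantumFields.YangMills.Theorems.CurvatureSandwichBound.Sketch.adm_iterate' u v hu hv
    f hfwin P hP m ⟨n, W⟩ hW hFW
  have hG₀off : IsOffDiagonal (linActMulti L (P^[m] ⟨n, W⟩).2) :=
    Summit.QuantumFields.YangMills.Theorems.CurvatureBoostCovariance.Negative.isOffDiagonal_linActMulti
      hadm.1.isOffDiagonal L
  have hG₀supp : tsupport ((linActMulti L (P^[m] ⟨n, W⟩).2 : 𝓢((Fin (P^[m] ⟨n, W⟩).1 → E4), ℂ)) :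
      (Fin (P^[m] ⟨n, W⟩).1 → E4) → ℂ) ⊆ {x | ∀ i, α₁ ≤ x i 0} := by
    have h1 := tsupport_chain hf hc0 hδ0 hg W hWt hs0.le P hP m
    have hmin : min (s - c - 2 * δ) (2 * (m : ℝ) * s - ℓW) = s - c - 2 * δ := min_eq_left (by linarith)
    rw [hmin] at h1
    exact tsupport_linAct_ge θ hcos hsin hk0.le _ h1
  -- (D): the unordered cloud
  have hJ₁s : tsupport ((translateMulti a J₁ : 𝓢((Fin 1 → E4), ℂ)) : (Fin 1 → E4) → ℂ) ⊆
      {x | α₁ ≤ x 0 0 ∧ x 0 0 ≤ α₁ + ℓ} := tsupport_translate_window hJ₁f a ha2 ha3 hw₁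
  have hJ₂s : tsupport ((translateMulti a J₂ : 𝓢((Fin 1 → E4), ℂ)) : (Fin 1 → E4) → ℂ) ⊆
      {x | α₁ + ℓ < x 0 0 ∧ x 0 0 ≤ α₂ + ℓ} := fun x hx => by
    obtain ⟨h1, h2⟩ := tsupport_translate_window hJ₂f a ha2 ha3 hw₂ hx
    exact ⟨by linarith, h2⟩
  obtain ⟨K, hK0, hK⟩ := stub_diagCloudGrowth S₁ h hE3 hreg a J₁ J₂ α₁ (α₁ + ℓ) (α₂ + ℓ) Lr hα₁0 (by linarith)
    (by linarith) (by linarith) hLr0 hJ₁s hJ₂s Q hQ hGrowth _ (linActMulti L (P^[m] ⟨n, W⟩).2) hG₀off hG₀supp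
  -- transport and conclusion
  obtain ⟨Λ, hΛ⟩ : ∃ Λ : ℝ, Λ = 2 * (3 : ℝ) ^ μ * C * Mg * (Mh + Mh') * (u ^ (-μ) + v ^ (-μ)) := ⟨_, rfl⟩
  have hΛ0 : 0 ≤ Λ := by rw [hΛ]; positivity
  have hLrΛ : Lr = Λ ^ 2 := by rw [hLr, hΛ, hB]; ring
  rw [← hΛ]
  refine ⟨K / Λ ^ (4 * m), by positivity, fun N hN => ?_⟩
  obtain ⟨M, rfl⟩ : ∃ M, N = M + 1 + m := ⟨N - (m + 1), by omega⟩
  have hSig : (⟨(P^[M + 1 + m] ⟨n, W⟩).1, linActMulti L (P^[M + 1 + m] ⟨n, W⟩).2⟩ :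
        Σ d : ℕ, 𝓢((Fin d → E4), ℂ)) =
      Q^[M + 1] ⟨(P^[m] ⟨n, W⟩).1, linActMulti L (P^[m] ⟨n, W⟩).2⟩ := by
    rw [Function.iterate_add_apply]
    exact transport L s f P Q hP hQ (M + 1) (P^[m] ⟨n, W⟩)
  have key := hK (M + 1)
  rw [← hSig] at key
  obtain ⟨hpos, hoff, hre⟩ := key
  refine ⟨hpos, hoff, ?_⟩
  have hre' : (S₁.osPairing (linActMulti L (P^[M + 1 + m] ⟨n, W⟩).2) (linActMulti L (P^[M + 1 + m] ⟨n, W⟩).2)).re ≤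
      K * Λ ^ (4 * (M + 1)) := by
    have : Lr ^ (2 * (M + 1)) = Λ ^ (4 * (M + 1)) := by rw [hLrΛ, ← pow_mul]; ring_nf
    rw [← this]; exact hre
  rcases hΛ0.eq_or_lt with hz | hpos'
  · -- degenerate rate: both sides vanish
    have hM1 : 4 * (M + 1) ≠ 0 := by omega
    have hM2 : 4 * (M + 1 + m) ≠ 0 := by omega
    rw [← hz, zero_pow hM1, mul_zero] at hre'
    rw [← hz, zero_pow hM2, mul_zero]
    exact hre'
  · calc _ ≤ K * Λ ^ (4 * (M + 1)) := hre'
      _ = K / Λ ^ (4 * m) * Λ ^ (4 * (M + 1 + m)) := by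
          rw [show 4 * (M + 1 + m) = 4 * (M + 1) + 4 * m by ring, pow_add]
          field_simp

end DiagGrowthT
open DiagGrowthT in
/-- **Stub (G) `stub_diagGrowthT`** of line `Sketch` v3.12 (registered text): growth of the unordered `e₀`-norms of a
box-localised diagonal chain — frame dictionary, transport, the landed (C) `stub_diagCorePeel` and (D)
`stub_diagCloudGrowth`, in the two frames `R = planeRot 0 (π/4)` (cloud read as `V ∘ R⁻¹`) and `R⁻¹` (cloud read as
`V ∘ R`), with `m + 1` periods absorbed into the cloud (`2m(2u+v) ≥ ℓ_W + 2u + v`, `ℓ_W` the sideways extent of the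
compact support of `W`). -/
theorem stub_diagGrowthT :
    open Literature.MathematicalPhysics.QuantumLattice Literature.MathematicalPhysics.AQFT
      Literature.MathematicalPhysics.QuantumFieldTheory
      Summit.QuantumFields.YangMills.Theorems.CurvatureSandwichBound.Negative
      Summit.QuantumFields.YangMills.Theorems.NPointIsotropy.Negative in
    ∀ (S₁ : SchwingerFamily E4) (h : OSReconstructionNoE1 S₁.toLabelled) (μ C : ℝ), 0 ≤ μ → 0 < C →
      S₁.toLabelled.IsSymmetric → NPointRegular S₁ → SandwichBound S₁ h μ C →
    ∀ (u v c : ℝ), 0 < u → 0 < v → u ≤ 1 → v ≤ 1 → u ≤ c → c + min u v / 32 ≤ 2 * u →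
    ∀ (f : SchwartzMap (Fin 1 → E4) ℂ) (g hh : ℝ × ℝ → ℂ) (Mg Mh Mh' : ℝ),
      (∀ x, f x = g (x 0 0, x 0 1) * hh (x 0 2, x 0 3)) →
      (∀ p, g p ≠ 0 → (c ≤ p.1 ∧ p.1 ≤ c + min u v / 32) ∧ |p.2| ≤ min u v / 32) →
      MeasureTheory.Integrable g → (∫ p, ‖g p‖) ≤ Mg → 0 < Mg →
      MeasureTheory.Integrable hh → (∫ p, ‖hh p‖) ≤ Mh → (∀ p, ‖hh p‖ ≤ Mh') →
    ∀ (n : ℕ) (W : SchwartzMap (Fin n → E4) ℂ), IsTimeOrdered W →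
      HasCompactSupport (W : (Fin n → E4) → ℂ) →
      IsTimeOrdered (f.appendTensor (translateMulti ((2 * u + v) • EuclideanSpace.single 0 1) W)) →
    ∀ (P : (Σ m : ℕ, SchwartzMap (Fin m → E4) ℂ) → (Σ m : ℕ, SchwartzMap (Fin m → E4) ℂ)),
      (P = fun Gσ => ⟨1 + (1 + Gσ.1), translateMulti ((2 * u + v) • EuclideanSpace.single 0 1)
        ((osAdjoint f).appendTensor
          (f.appendTensor (translateMulti ((2 * u + v) • EuclideanSpace.single 0 1) Gσ.2)))⟩) →
    ∃ K : ℝ, 0 ≤ K ∧ ∃ m : ℕ, ∀ N : ℕ, m ≤ N →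
      IsPositiveTimeMulti (linActMulti (planeRot (0 : Fin 3) (Real.pi / 4)).symm (P^[N] ⟨n, W⟩).2) ∧
      IsOffDiagonal (linActMulti (planeRot (0 : Fin 3) (Real.pi / 4)).symm (P^[N] ⟨n, W⟩).2) ∧
      IsPositiveTimeMulti (linActMulti (planeRot (0 : Fin 3) (Real.pi / 4)) (P^[N] ⟨n, W⟩).2) ∧
      IsOffDiagonal (linActMulti (planeRot (0 : Fin 3) (Real.pi / 4)) (P^[N] ⟨n, W⟩).2) ∧
      (fun n' => (S₁ n').comp (linActMulti (planeRot (0 : Fin 3) (Real.pi / 4))) : SchwingerFamily E4)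
          ((P^[N] ⟨n, W⟩).1 + (P^[N] ⟨n, W⟩).1)
          ((osAdjoint (P^[N] ⟨n, W⟩).2).appendTensor (P^[N] ⟨n, W⟩).2) =
        S₁.osPairing (linActMulti (planeRot (0 : Fin 3) (Real.pi / 4)).symm (P^[N] ⟨n, W⟩).2)
          (linActMulti (planeRot (0 : Fin 3) (Real.pi / 4)) (P^[N] ⟨n, W⟩).2) ∧
      (S₁.osPairing (linActMulti (planeRot (0 : Fin 3) (Real.pi / 4)).symm (P^[N] ⟨n, W⟩).2)
          (linActMulti (planeRot (0 : Fin 3) (Real.pi / 4)).symm (P^[N] ⟨n, W⟩).2)).re ≤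
        K * (2 * (3 : ℝ) ^ μ * C * Mg * (Mh + Mh') * (u ^ (-μ) + v ^ (-μ))) ^ (4 * N) ∧
      (S₁.osPairing (linActMulti (planeRot (0 : Fin 3) (Real.pi / 4)) (P^[N] ⟨n, W⟩).2)
          (linActMulti (planeRot (0 : Fin 3) (Real.pi / 4)) (P^[N] ⟨n, W⟩).2)).re ≤
        K * (2 * (3 : ℝ) ^ μ * C * Mg * (Mh + Mh') * (u ^ (-μ) + v ^ (-μ))) ^ (4 * N) := by
  intro S₁ h μ C hμ hC hE3 hreg hSB u v c hu hv hu1 hv1 huc hc2 f g hh Mg Mh Mh' hf hg hgi hgM hMg hhi hhM hhM'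
    n W hW hWc hFW P hP
  -- sideways extent of the cloud
  obtain ⟨Rb, hRb⟩ := hWc.isCompact.isBounded.exists_norm_le
  have hWt : tsupport (W : (Fin n → E4) → ℂ) ⊆ {x | ∀ i, 0 ≤ x i 0 ∧ |x i 1| ≤ max Rb 0} := by
    intro x hx i
    refine ⟨(hW hx).1 i |>.le, ?_⟩
    calc |x i 1| = ‖x i 1‖ := (Real.norm_eq_abs _).symm
      _ ≤ ‖x i‖ := PiLp.norm_apply_le (x i) 1
      _ ≤ ‖x‖ := norm_le_pi_norm x i
      _ ≤ Rb := hRb x hx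
      _ ≤ max Rb 0 := le_max_left _ _
  -- the number of absorbed periods
  have hs0 : 0 < 2 * u + v := by linarith
  obtain ⟨m, hm⟩ : ∃ m : ℕ, max Rb 0 + (2 * u + v) ≤ 2 * m * (2 * u + v) := by
    refine ⟨⌈(max Rb 0 + (2 * u + v)) / (2 * (2 * u + v))⌉₊, ?_⟩
    have h1 := Nat.le_ceil ((max Rb 0 + (2 * u + v)) / (2 * (2 * u + v)))
    rw [div_le_iff₀ (by linarith)] at h1
    linarith
  have hc4 : Real.cos (Real.pi / 4) = Real.sqrt 2 / 2 := Real.cos_pi_div_four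
  have hs4 : |Real.sin (Real.pi / 4)| = Real.sqrt 2 / 2 := by
    rw [Real.sin_pi_div_four, abs_of_nonneg (by positivity)]
  have hc4' : Real.cos (-(Real.pi / 4)) = Real.sqrt 2 / 2 := by rw [Real.cos_neg, hc4]
  have hs4' : |Real.sin (-(Real.pi / 4))| = Real.sqrt 2 / 2 := by rw [Real.sin_neg, abs_neg, hs4]
  obtain ⟨K₁, hK₁0, hK₁⟩ := frame_growth S₁ h hμ hC hE3 hreg hSB hu hv hu1 hv1 huc hc2 hf hg hgi hgM hMg hhi hhM
    hhM' W hW hWt hFW P hP m hm (Real.pi / 4) hc4 hs4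
  obtain ⟨K₂, hK₂0, hK₂⟩ := frame_growth S₁ h hμ hC hE3 hreg hSB hu hv hu1 hv1 huc hc2 hf hg hgi hgM hMg hhi hhM
    hhM' W hW hWt hFW P hP m hm (-(Real.pi / 4)) hc4' hs4'
  refine ⟨K₁ + K₂, by positivity, m + 1, fun N hN => ?_⟩
  obtain ⟨h3, h4, h7⟩ := hK₁ N hN
  obtain ⟨h1, h2, h6⟩ := hK₂ N hN
  rw [← linActMulti_planeRot_symm] at h1 h2 h6
  have hΛN : 0 ≤ (2 * (3 : ℝ) ^ μ * C * Mg * (Mh + Mh') * (u ^ (-μ) + v ^ (-μ))) ^ (4 * N) := by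
    have hMh0 : 0 ≤ Mh := (integral_nonneg fun _ => norm_nonneg _).trans hhM
    have hMh'0 : 0 ≤ Mh' := (norm_nonneg _).trans (hhM' 0)
    positivity
  refine ⟨h1, h2, h3, h4, frame_dictionary S₁ (Real.pi / 4) _, ?_, ?_⟩
  · exact h6.trans (mul_le_mul_of_nonneg_right (by linarith) hΛN)
  · exact h7.trans (mul_le_mul_of_nonneg_right (by linarith) hΛN)

end Summit.QuantumFields.YangMills.Theorems.SoftKernelBoostCovariance.Sketch

end
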